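import Summits.KontsevichZagierPeriods.KontsevichZagierPeriods.Theses.OctahedralSymmetry
import Summits.KontsevichZagierPeriods.KontsevichZagierPeriods.Theorems.FurushoPentagonHoffmanRelationInKZCubicalTransportAux2

/-!
# `LevelFourStuffleInKZ` (stmt-KontsevichZagierPeriods-9434, route `OctahedralSymmetry`), line `Sketch`:
# stub `stub_transportCubical`

ONE change-of-variables move of the KZ calculus: a representation `A` on the literal ordered simplex
`{1 > t₀ > t₁ > t₂ > 0}` is KZ-equivalent to its pull-back `At` on the open cube `(0,1)³` along the
cumulative chart `Φ(s) = (s₀, s₀s₁, s₀s₁s₂)`, whose Jacobian determinant is `s₀²s₁ > 0`; the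
pulled-back representation EXISTS because integrability is transported along the chart. Everything
is the instance `N = 3` of the monomial-chart toolkit of
`FurushoPentagonHoffmanRelationInKZCubicalTransportAux{,2}.lean` (`monomialChart_transport`,
`injOn_cubicalChart`, `image_cubicalChart`, `cubicalChart_diag`); what is added is the bookkeeping
on `Fin 3` (the literal simplex is `KZ.openOrderedSimplex 3`, the chart is `![s₀, s₀s₁, s₀s₁s₂]`,
the Jacobian is `s₀²s₁`).

References: M. Kontsevich, D. Zagier, *Periods* (2001), §1.2 rule (2).
-/

noncomputable section

open Set MeasureTheory
open Literature.NumberTheory.Transcendental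
open Literature.NumberTheory.Transcendental.KZ
open Summit.KontsevichZagierPeriods.FurushoPentagon.HoffmanRelationInKZ (monomialChart_transport
  cubicalChart_diag cubicalChart_rows injOn_cubicalChart image_cubicalChart partialProd_zero
  partialProd_succ)

namespace Summit.KontsevichZagierPeriods.OctahedralSymmetry.LevelFourStuffleInKZ

/-- The literal ordered simplex `{1 > t₀ > t₁ > t₂ > 0}` of `ℝ³` is Kontsevich's open ordered
simplex `KZ.openOrderedSimplex 3`. [folklore] -/
theorem setOf_ordered_three_eq_openOrderedSimplex :
    {t : Fin 3 → ℝ | 1 > t 0 ∧ t 0 > t 1 ∧ t 1 > t 2 ∧ t 2 > 0} = openOrderedSimplex 3 := by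
  ext t
  simp only [mem_setOf_eq, openOrderedSimplex, gt_iff_lt, Fin.strictAnti_iff_succ_lt,
    Fin.forall_fin_succ]
  constructor
  · rintro ⟨h0, h1, h2, h3⟩
    refine ⟨⟨?_, ?_, ?_⟩, ⟨h0, ?_, ?_⟩, ?_, ?_⟩
    · linarith
    · simpa using (h3.trans h2)
    · simpa using h3
    · simpa using (h1.trans h0)
    · simpa using (h2.trans (h1.trans h0))
    · simpa using h1
    · simpa using h2
  · rintro ⟨⟨-, -, h3⟩, ⟨h0, -, -⟩, h1, h2⟩
    exact ⟨h0, by simpa using h1, by simpa using h2, by simpa using h3⟩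

/-- The open cube `(0,1)³` is `ℚ`-semialgebraic (the intersection of the strict polynomial
inequalities `sᵢ > 0`, `1 - sᵢ > 0`). [folklore] -/
theorem isSemialgebraic_openCube_three :
    Literature.ModelTheory.ExponentialFields.IsSemialgebraic ℚ
      {s : Fin 3 → ℝ | ∀ i, s i ∈ Set.Ioo (0:ℝ) 1} := by
  have : {s : Fin 3 → ℝ | ∀ i, s i ∈ Set.Ioo (0:ℝ) 1} = ⋂ i ∈ (Finset.univ : Finset (Fin 3)),
      ({x : Fin 3 → ℝ | 0 < MvPolynomial.aeval x (MvPolynomial.X i : MvPolynomial (Fin 3) ℚ)} ∩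
        {x | 0 < MvPolynomial.aeval x (1 - MvPolynomial.X i : MvPolynomial (Fin 3) ℚ)}) := by
    ext x
    simp [Set.mem_Ioo, sub_pos]
  rw [this]
  exact Literature.ModelTheory.ExponentialFields.IsSemialgebraic.biInter _ _ fun i _ =>
    (Literature.ModelTheory.ExponentialFields.isSemialgebraic_setOf_eval_pos (k := ℚ) _).inter
      (Literature.ModelTheory.ExponentialFields.isSemialgebraic_setOf_eval_pos (k := ℚ) _)

/-- **Stub `stub_transportCubical`** (rule 2, one move): every representation on the literal ordered
simplex `{1 > t₀ > t₁ > t₂ > 0}` has a pull-back to the open cube along the cumulative chart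
`s ↦ (s₀, s₀s₁, s₀s₁s₂)` (Jacobian `s₀²s₁`), KZ-equivalent to it: the instance `N = 3` of
`monomialChart_transport`. [cite: KontsevichZagier2001, §1.2 rule (2)] -/
theorem stub_transportCubical (A : IntegralRep 3)
    (hA : A.domain = {t | 1 > t 0 ∧ t 0 > t 1 ∧ t 1 > t 2 ∧ t 2 > 0}) :
    ∃ At : IntegralRep 3, At.domain = {s | ∀ i, s i ∈ Set.Ioo (0:ℝ) 1} ∧
      (∀ s ∈ {s : Fin 3 → ℝ | ∀ i, s i ∈ Set.Ioo (0:ℝ) 1},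
        At.integrand s = A.integrand ![s 0, s 0 * s 1, s 0 * s 1 * s 2] * (s 0 ^ 2 * s 1)) ∧
      of At - of A ∈ relations := by
  -- the cubical chart in the toolkit's normal form
  set T : ℕ → (Fin 3 → ℝ) → ℝ := fun m x => ∏ j : Fin 3, if (j : ℕ) < m then x j else 1
    with hT_def
  have hT : ∀ m x, T m x = ∏ j : Fin 3, if (j : ℕ) < m then x j else 1 := fun _ _ => rfl
  set S : Fin 3 → Finset (Fin 3) := fun i =>
    Finset.univ.filter (fun j : Fin 3 => (j : ℕ) < (i : ℕ) + 1) with hS_def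
  set Φ : (Fin 3 → ℝ) → (Fin 3 → ℝ) := fun x i => ∏ j ∈ S i, x j with hΦ_def
  have hΦ : ∀ x i, Φ x i =
      ∏ j ∈ Finset.univ.filter (fun j : Fin 3 => (j : ℕ) < (i : ℕ) + 1), x j := fun _ _ => rfl
  obtain ⟨hS, hS'⟩ := cubicalChart_rows 3
  set D : Set (Fin 3 → ℝ) := {s | ∀ i, s i ∈ Set.Ioo (0:ℝ) 1} with hD_def
  have hinj : InjOn Φ D := injOn_cubicalChart T hT Φ hΦ
  have himg : Φ '' D = openOrderedSimplex 3 := image_cubicalChart T hT Φ hΦ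
  have hD : Literature.ModelTheory.ExponentialFields.IsSemialgebraic ℚ D :=
    isSemialgebraic_openCube_three
  -- the chart and its Jacobian, explicitly on `Fin 3`
  have hT0 : ∀ s, T 0 s = 1 := fun s => partialProd_zero T hT s
  have hT1 : ∀ s, T 1 s = s 0 := fun s => by
    rw [partialProd_succ T hT, hT0, one_mul, dif_pos (by norm_num)]; rfl
  have hT2 : ∀ s, T 2 s = s 0 * s 1 := fun s => by
    rw [partialProd_succ T hT, hT1, dif_pos (by norm_num)]; rfl
  have hT3 : ∀ s, T 3 s = s 0 * s 1 * s 2 := fun s => by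
    rw [partialProd_succ T hT, hT2, dif_pos (by norm_num)]; rfl
  have hΦs : ∀ s, Φ s = ![s 0, s 0 * s 1, s 0 * s 1 * s 2] := by
    intro s
    have hc : ∀ i, Φ s i = T ((i : ℕ) + 1) s := fun i => by
      rw [hΦ, hT, Finset.prod_filter]
    funext i
    fin_cases i
    · simpa using (hc 0).trans (hT1 s)
    · simpa using (hc 1).trans (hT2 s)
    · simpa using (hc 2).trans (hT3 s)
  have hjac : ∀ s ∈ D, |∏ i, ∏ k ∈ (S i).erase i, s k| = s 0 ^ 2 * s 1 := by
    intro s hs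
    have hs' : ∀ i, s i ∈ Ioo (0 : ℝ) 1 := hs
    have hdiag : ∀ i, ∏ k ∈ (S i).erase i, s k = T i s := fun i => cubicalChart_diag T hT s i
    simp only [hdiag, Fin.prod_univ_three, Fin.val_zero, Fin.val_one, Fin.val_two, hT0, hT1, hT2]
    rw [abs_of_pos (mul_pos (mul_pos one_pos (hs' 0).1) (mul_pos (hs' 0).1 (hs' 1).1))]
    ring
  -- one change of variables along the chart
  have hgh : ∀ y ∈ D,
      (fun s : Fin 3 → ℝ => A.integrand ![s 0, s 0 * s 1, s 0 * s 1 * s 2] * (s 0 ^ 2 * s 1)) y =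
        A.integrand (Φ y) * |∏ i, ∏ k ∈ (S i).erase i, y k| := by
    intro y hy
    simp only [hjac y hy, hΦs y]
  obtain ⟨hex, heq⟩ := monomialChart_transport S hS hS' hD Φ (fun _ _ => rfl) hinj
    (fun s : Fin 3 → ℝ => A.integrand ![s 0, s 0 * s 1, s 0 * s 1 * s 2] * (s 0 ^ 2 * s 1))
    A.integrand hgh
  have hAd : A.domain = Φ '' D := by
    rw [hA, himg]
    exact setOf_ordered_three_eq_openOrderedSimplex
  have hAi : EqOn A.integrand A.integrand A.domain := fun _ _ => rfl
  obtain ⟨At, hAtd, hAti⟩ := hex A hAd hAi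
  exact ⟨At, hAtd, fun s _ => by rw [hAti], heq At A hAtd (fun x _ => by rw [hAti]) hAd hAi⟩

end Summit.KontsevichZagierPeriods.OctahedralSymmetry.LevelFourStuffleInKZ
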